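import Summits.QuantumFields.BalabanUV.Beta.GAN24.DirichletExhaustionTails
import Summits.QuantumFields.BalabanUV.Beta.GAN24.DirichletExhaustionElimZ

/-!
# `BalabanUV.Beta.GAN24.DirichletExhaustionCoerDict` — binder row G-an2-4 / (CONV-C), part P2, PART 16 = skeleton node S3.c: the DICTIONARY
# between pv09-g6's torus constraints and the `ℤ^{d+1}` constraints OFF THE SEAM — translation invariance of `Δᶻ_k`, `Lℤ^{d+1}`-invariance of
# the tree bonds, translation covariance of the block-average multiplicities, `multP = mult` (no wrapping) at box points `z` with
# `z_μ ≥ L − 1`, torus trees ⇒ `ℤ^{d+1}` trees, and the box-sum bookkeeping of translated finitely supported fields (unit b2b-balaban-gan24-p2,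
# gen 2, v1)

HONEST FRAMING (cell contract, verbatim): «discharging `BetaPertH` makes Bałaban's UV stability UNCONDITIONAL — a real constructive-QFT
result; it is NOT the continuum limit and NOT the Clay problem.»  Skeleton `HOME/b2b-balaban-gan24-p2/gen1/SKELETON-P2.md` node S3.c, used by
PART 17 (`DirichletExhaustionCoerZ.lower2153_Z`, S3.e) to pull pv09-g6's torus lower bound (2.153) back to `ℤ^{d+1}`.  [folklore] bookkeeping on
b06-g3's `mult`/`hits`/`IsTree`, pv09-g6's `multP`/`hitsP`, `B6Lemma24Torus.pbox`/`wrap`; nothing printed is used as a hypothesis; NOT `BetaPertH`,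
NOT continuum, NOT Clay.  «not in print; our proof attempt».

ABSOLUTE RULE (cell, verbatim): «No internally-minted statement may enter as a cited fact. Every hypothesis is either kernel-proved in this
package or a verbatim quotation of a PUBLISHED theorem with page reference. The manuscript(s) under audit are NOT citable for their own disputed
steps — they are the thing under adjudication; programme-internal (2001/route/tribunal) claims are never citable.»

WHAT IS PROVED (0 sorry): `deltaZ_translate_sub`, `corner_add_of_dvd`, `isTreeZ_add_iff`, `mult_translate`, **`multP_eq_mult`** (S3.c),
`isTreeZ_of_isTree`, `sum_box_translate`, `exists_coord_bound`, `sum_sum_mul_le`.  NOT summit progress.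
-/

namespace Summit.QuantumFields.BalabanUV.Beta.GAN24.DirichletExhaustionCoerDict

open Finset Real
open Literature.MathematicalPhysics.QuantumFieldTheory.Balaban1983to89
open B6Elimination (corner block mem_block corner_apply)
open B6BondElimination (unitVec add_smul_unitVec_apply pivSite cOf hits mem_hits mult IsTree)
open B6Lemma24Torus (pbox mem_pbox coarseSites coarseSites_dvd faces mem_faces wrap wrap_eq_self block_subset_pbox mem_block_add)
open B6Lemma24PrintedShape (q1)
open B6Cov2156Torus (hitsP mem_hitsP multP perExt q1_perExt_eq_sum_multP lowerOnConstrainedT_of_represents represents_deltaPol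
  gamma2153 deltaPol quad_eq_sum_sum)
open B4Sect5Exhaustion (K)
open Summit.QuantumFields.BalabanUV.Beta.GAN24.DirichletExhaustionDeltaZ (deltaZ kappaZ kappaZ_pos)
open Summit.QuantumFields.BalabanUV.Beta.GAN24.DirichletExhaustionTails (tailConst deltaPol_sub_deltaZ_abs_le)
open Summit.QuantumFields.BalabanUV.Beta.GAN24.DirichletExhaustionElimZ (IsTreeZ)

noncomputable section

variable {d : ℕ}

/-! ## §1 Translations of `ℤ^{d+1}` -/

/-- **`Δᶻ_k` is translation-invariant** (its kernel depends on `x − y` only). -/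
theorem deltaZ_translate_sub (L : ℕ) [NeZero L] (k : ℕ) (x y t : Fin (d + 1) → ℤ) (α β : Fin (d + 1)) :
    deltaZ L k (x - t, α) (y - t, β) = deltaZ L k (x, α) (y, β) := by
  unfold deltaZ
  simp only [sub_sub_sub_cancel_right]

/-- Corners commute with `Lℤ^{d+1}`-translations: `corner (x + t) = corner x + t` for `t ∈ Lℤ^{d+1}`. -/
theorem corner_add_of_dvd {L : ℕ} (hL : 0 < L) (x t : Fin (d + 1) → ℤ) (ht : ∀ i, (L : ℤ) ∣ t i) :
    corner L (x + t) = corner L x + t := by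
  funext i
  obtain ⟨m, hm⟩ := ht i
  rw [Pi.add_apply, corner_apply, corner_apply, Pi.add_apply, hm]
  have hL0 : (L : ℤ) ≠ 0 := by exact_mod_cast hL.ne'
  rw [Int.add_mul_ediv_left _ _ hL0, mul_add]

/-- **Tree bonds are `Lℤ^{d+1}`-invariant**: `⟨x + t, x + t + e_α⟩` is a tree bond of its block iff `⟨x, x + e_α⟩` is (`t ∈ Lℤ^{d+1}`). -/
theorem isTreeZ_add_iff {L : ℕ} (hL : 0 < L) (x t : Fin (d + 1) → ℤ) (ht : ∀ i, (L : ℤ) ∣ t i) (α : Fin (d + 1)) :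
    IsTreeZ L (x + t, α) ↔ IsTreeZ L (x, α) := by
  unfold IsTreeZ
  simp only [corner_add_of_dvd hL x t ht, Pi.add_apply]
  constructor
  · rintro ⟨h1, h2⟩
    exact ⟨by omega, fun i hi => by have := h2 i hi; omega⟩
  · rintro ⟨h1, h2⟩
    exact ⟨by omega, fun i hi => by have := h2 i hi; omega⟩

/-- **Multiplicities are translation-covariant**: `mult L (c₋ + t, μ) (z + t) ν = mult L c z ν` for every `t ∈ ℤ^{d+1}` (blocks and straight
contours translate rigidly). -/
theorem mult_translate (L : ℕ) (c : (Fin (d + 1) → ℤ) × Fin (d + 1)) (z t : Fin (d + 1) → ℤ) (ν : Fin (d + 1)) :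
    mult L (c.1 + t, c.2) (z + t) ν = mult L c z ν := by
  classical
  unfold mult
  dsimp only
  split_ifs with hν
  · refine Finset.card_nbij' (fun xs => (xs.1 - t, xs.2)) (fun xs => (xs.1 + t, xs.2)) ?_ ?_ ?_ ?_
    · intro xs hxs
      obtain ⟨⟨hx, hs⟩, hz⟩ := mem_hits.1 hxs
      refine mem_hits.2 ⟨⟨mem_block_add.1 hx, hs⟩, ?_⟩
      dsimp only
      rw [sub_add_eq_add_sub, hz, add_sub_cancel_right]
    · intro xs hxs
      obtain ⟨⟨hx, hs⟩, hz⟩ := mem_hits.1 hxs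
      refine mem_hits.2 ⟨⟨mem_block_add.2 (by rwa [add_sub_cancel_right]), hs⟩, ?_⟩
      dsimp only
      rw [add_right_comm, hz]
    · intro xs _
      simp
    · intro xs _
      simp
  · rfl

/-! ## §2 Torus ↔ `ℤ^{d+1}` off the seam (S3.c) -/

/-- **No wrapping off the seam (S3.c)**: for a face `c` of the torus (`L ∣ M_i`) and a box point `z` with `z_{μ(c)} ≥ L − 1`, the PERIODIC
multiplicity of pv09-g6's torus average equals b06's `ℤ^{d+1}` multiplicity: `multP L M c z ν = mult L c z ν`. -/
theorem multP_eq_mult {L : ℕ} {M : Fin (d + 1) → ℕ} (hLM : ∀ i, L ∣ M i) {c : (Fin (d + 1) → ℤ) × Fin (d + 1)}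
    (hc : c ∈ faces L M) {z : Fin (d + 1) → ℤ} (hz : z ∈ pbox M) (hdeep : (L : ℤ) - 1 ≤ z c.2) (ν : Fin (d + 1)) :
    multP L M c z ν = mult L c z ν := by
  classical
  unfold multP mult
  split_ifs with hν
  · congr 1
    ext xs
    rw [mem_hitsP, mem_hits]
    refine and_congr_right fun hxs => ?_
    have hxbox : xs.1 ∈ pbox M := block_subset_pbox hLM (mem_faces.1 hc) hxs.1
    constructor
    · intro h
      funext i
      have hi := congrFun h i
      simp only [wrap, add_smul_unitVec_apply] at hi
      rw [add_smul_unitVec_apply]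
      obtain ⟨hx0, hxM⟩ := mem_pbox.1 hxbox i
      obtain ⟨hz0, hzM⟩ := mem_pbox.1 hz i
      by_cases hiμ : i = c.2
      · rw [if_pos hiμ] at hi ⊢
        have hs : (xs.2 : ℤ) < L := by exact_mod_cast hxs.2
        have hs0 : (0 : ℤ) ≤ xs.2 := by positivity
        have hMpos : (0 : ℤ) < (M i : ℤ) := by omega
        have hLM' : (L : ℤ) ≤ (M i : ℤ) := Int.le_of_dvd hMpos (Int.natCast_dvd_natCast.2 (hLM i))
        by_cases hlt : xs.1 i + xs.2 < M i
        · rw [Int.emod_eq_of_lt (by omega) hlt] at hi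
          exact hi
        · exfalso
          have e : (xs.1 i + (xs.2 : ℤ)) % (M i : ℤ) = xs.1 i + (xs.2 : ℤ) - (M i : ℤ) := by
            have h3 : xs.1 i + (xs.2 : ℤ) = (xs.1 i + (xs.2 : ℤ) - (M i : ℤ)) + (M i : ℤ) * 1 := by ring
            rw [h3, Int.add_mul_emod_self_left, Int.emod_eq_of_lt (by omega) (by omega)]
            ring
          rw [e] at hi
          subst hiμ
          omega
      · rw [if_neg hiμ] at hi ⊢
        rw [add_zero, Int.emod_eq_of_lt hx0 hxM] at hi
        rw [add_zero]
        exact hi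
    · intro h
      rw [h]
      exact wrap_eq_self hz
  · rfl

/-- The torus tree predicate (trees of the coarse sites of the box) implies the `ℤ^{d+1}` tree predicate at the representative. -/
theorem isTreeZ_of_isTree {L : ℕ} {M : Fin (d + 1) → ℕ} {p : B4.Idx (pbox M) (d + 1)}
    (h : IsTree L (coarseSites L M) p) : IsTreeZ L ((p.1 : Fin (d + 1) → ℤ), p.2) :=
  ⟨h.2.1, h.2.2⟩

/-! ## §3 Box sums of translated finitely supported functions -/

/-- **Box sums of a translate**: if `g` vanishes off the finite `R` and `R + t` lies in the box, then
`Σ_{b ∈ box bonds} g(b₋ − t, ν(b)) = Σ_{r ∈ R} g r`. -/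
theorem sum_box_translate {M : Fin (d + 1) → ℕ} (t : Fin (d + 1) → ℤ) (R : Finset (K (d + 1) (d + 1)))
    (g : K (d + 1) (d + 1) → ℝ) (hg : ∀ r, r ∉ R → g r = 0) (hR : ∀ r ∈ R, r.1 + t ∈ pbox M) :
    ∑ b : B4.Idx (pbox M) (d + 1), g ((b.1 : Fin (d + 1) → ℤ) - t, b.2) = ∑ r ∈ R, g r := by
  classical
  let e : B4.Idx (pbox M) (d + 1) ↪ K (d + 1) (d + 1) :=
    ⟨fun b => ((b.1 : Fin (d + 1) → ℤ) - t, b.2), fun b b' h => by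
      obtain ⟨h1, h2⟩ := Prod.ext_iff.1 h
      exact Prod.ext (Subtype.ext (sub_left_injective h1)) h2⟩
  have hmap : ∑ b : B4.Idx (pbox M) (d + 1), g ((b.1 : Fin (d + 1) → ℤ) - t, b.2) = ∑ r ∈ Finset.univ.map e, g r := by
    rw [Finset.sum_map]
    rfl
  rw [hmap]
  symm
  refine Finset.sum_subset (fun r hr => ?_) (fun r _ hr => hg r hr)
  rw [Finset.mem_map]
  refine ⟨(⟨r.1 + t, hR r hr⟩, r.2), Finset.mem_univ _, ?_⟩
  simp [e]

/-- A coordinate bound for a finite set of bonds: `∃ A, ∀ r ∈ R, ∀ i, |r₋(i)| ≤ A`. -/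
theorem exists_coord_bound (R : Finset (K (d + 1) (d + 1))) : ∃ A : ℕ, ∀ r ∈ R, ∀ i, |r.1 i| ≤ A := by
  classical
  refine ⟨R.sup fun r => Finset.univ.sup fun i => (r.1 i).natAbs, fun r hr i => ?_⟩
  have h1 : (r.1 i).natAbs ≤ Finset.univ.sup fun j => (r.1 j).natAbs :=
    Finset.le_sup (f := fun j => (r.1 j).natAbs) (Finset.mem_univ i)
  have h2 : (Finset.univ.sup fun j => (r.1 j).natAbs) ≤ R.sup fun r => Finset.univ.sup fun j => (r.1 j).natAbs :=
    Finset.le_sup (f := fun r : K (d + 1) (d + 1) => Finset.univ.sup fun j => (r.1 j).natAbs) hr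
  have h3 := h1.trans h2
  rw [← Int.natCast_natAbs]
  exact_mod_cast h3

/-- **Termwise comparison of double sums**: if `|X − Y| ≤ E` on the support of `B`, then
`Σ_{p,q} B_pB_q X_{pq} ≤ Σ_{p,q} B_pB_q Y_{pq} + E·(Σ_p |B_p|)²`. -/
theorem sum_sum_mul_le {ι : Type*} [Fintype ι] (B : ι → ℝ) (X Y : ι → ι → ℝ) {E : ℝ}
    (h : ∀ p q, B p ≠ 0 → B q ≠ 0 → |X p q - Y p q| ≤ E) :
    ∑ p, ∑ q, B p * B q * X p q ≤ (∑ p, ∑ q, B p * B q * Y p q) + E * (∑ p, |B p|) ^ 2 := by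
  have hterm : ∀ p q, B p * B q * X p q ≤ B p * B q * Y p q + E * (|B p| * |B q|) := by
    intro p q
    by_cases hp : B p = 0
    · simp [hp]
    by_cases hq : B q = 0
    · simp [hq]
    have h1 := h p q hp hq
    have h2 : B p * B q * X p q - B p * B q * Y p q = (B p * B q) * (X p q - Y p q) := by ring
    have h3 : |B p * B q * X p q - B p * B q * Y p q| ≤ |B p| * |B q| * E := by
      rw [h2, abs_mul, abs_mul]
      exact mul_le_mul_of_nonneg_left h1 (by positivity)
    have h4 := (le_abs_self _).trans h3
    nlinarith
  calc ∑ p, ∑ q, B p * B q * X p q ≤ ∑ p, ∑ q, (B p * B q * Y p q + E * (|B p| * |B q|)) :=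
        Finset.sum_le_sum fun p _ => Finset.sum_le_sum fun q _ => hterm p q
    _ = (∑ p, ∑ q, B p * B q * Y p q) + E * (∑ p, |B p|) ^ 2 := by
        simp only [Finset.sum_add_distrib]
        congr 1
        rw [sq, Finset.sum_mul_sum, Finset.mul_sum]
        refine Finset.sum_congr rfl fun p _ => ?_
        rw [Finset.mul_sum]

end

end Summit.QuantumFields.BalabanUV.Beta.GAN24.DirichletExhaustionCoerDict
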